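import Mathlib.Data.Set.Card
import Literature.MathematicalPhysics.StatisticalMechanics.BarlowStacking
import HarnessLib

/-!
# Every close-packed Barlow stacking is twelve-coordinated (Hales, *Dense Sphere Packings* §1.3)

Topic: `Literature/MathematicalPhysics/StatisticalMechanics`; complement to `BarlowStacking.lean`,
which lists as "not formalised here": *every point has exactly twelve points at distance `a`
when `h = a√(2/3)`* (Hales, *Dense Sphere Packings*, §1.3: "In each of these packings the tangent
arrangement around each ball is the FCC or HCP arrangement"; Conway–Sloane, Preface to the 3rd
ed., Notes on Ch. 4: for any Barlow packing the coordination sequence satisfies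
`10n² + 2 ≤ S(n) ≤ ⌊21n²/2⌋ + 2`, whence `S(1) = 12`). This file PROVES it, together with the
packing property, for every Hägg sequence `s` (every walk on the letters `A, B, C`), in-layer
spacing `a > 0` and the ideal layer spacing `h`, `h² = ⅔ a²`:

* `le_dist_barlowPos_of_ideal` — distinct points of `barlowStacking a h s` are at distance `≥ a`
  (the stacking is a packing of balls of diameter `a`);
* `dist_barlowPos_eq_iff` — the points at distance exactly `a` from `barlowPos a h s k i j` are:
  six in its own layer, three in layer `k + 1`, three in layer `k − 1` (which three depends on
  the letters `s k`, `s (k−1)`);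
* `ncard_touching_barlowPos` — hence exactly **twelve** points of the stacking at distance `a`
  from each of its points; `ncard_touching_eq_twelve` — the same for an arbitrary point of the
  stacking.

Used by `Literature/Barriers/AtomisticToContinuum/KissingTwelveDegeneracy.lean` (all Barlow
stackings are packings with kissing number twelve, so twelve contacts never select a stacking).

## Method

With `P = i − i'`, `Q = j − j'`, `K = k − k'`, `Λ = L(k) − L(k')` (layer labels `L = haggLabel s`),
`BarlowStacking.dist_barlowPos_sq` and `h² = ⅔a²` give
`12 · dist² = a² · (3(2P + Q + Λ)² + (3Q + Λ)² + 8K²)` (`twelve_mul_dist_barlowPos_sq`), an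
integer quadratic form; `dist = a` becomes `3(2P+Q+Λ)² + (3Q+Λ)² + 8K² = 12`, forcing `|K| ≤ 1`,
and for a Hägg sequence `Λ = 0` (`K = 0`), `Λ = −s k` (`k' = k+1`), `Λ = s (k−1)` (`k' = k−1`);
the finitely many integer solutions are enumerated (`inLayer_eq_twelve_iff`,
`adjLayer_pos_eq_four_iff`, `adjLayer_neg_eq_four_iff`), and the lower bounds
`twelve_le_inLayer`, `four_le_adjLayer` give the packing property.

## References

* T. C. Hales, *Dense Sphere Packings: a blueprint for formal proofs*, LMS LN 400 (2012), §1.3.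
* J. H. Conway, N. J. A. Sloane, *Sphere Packings, Lattices and Groups*, 3rd ed. (1999), Preface
  to the 3rd ed., Notes on Ch. 4 ("Coordination sequences"); Ch. 4 §6.3, §6.5 (`τ = 12`).
-/

noncomputable section

open Set

namespace Literature.MathematicalPhysics.StatisticalMechanics

/-! ## Integer lemmas: the solutions of the shell equations -/

/-- `u² ≤ 1 ⇒ |u| ≤ 1`. [folklore] -/
theorem abs_le_one_of_sq_le_one {u : ℤ} (h : u ^ 2 ≤ 1) : -1 ≤ u ∧ u ≤ 1 := by
  constructor <;> nlinarith

/-- `u² ≤ 4 ⇒ |u| ≤ 2`. [folklore] -/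
theorem abs_le_two_of_sq_le_four {u : ℤ} (h : u ^ 2 ≤ 4) : -2 ≤ u ∧ u ≤ 2 := by
  constructor <;> nlinarith

/-- **In-layer shell**: `3(2P+Q)² + (3Q)² = 12` (i.e. `P² + PQ + Q² = 1`) has exactly the six
solutions `(±1, 0), (0, ±1), ±(1, −1)` — the six neighbours in a triangular layer. [folklore] -/
theorem inLayer_eq_twelve_iff (P Q : ℤ) :
    3 * (2 * P + Q) ^ 2 + (3 * Q) ^ 2 = 12 ↔
      (P = 1 ∧ Q = 0) ∨ (P = -1 ∧ Q = 0) ∨ (P = 0 ∧ Q = 1) ∨ (P = 0 ∧ Q = -1) ∨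
        (P = 1 ∧ Q = -1) ∨ (P = -1 ∧ Q = 1) := by
  constructor
  · intro h
    have hQ : Q ^ 2 ≤ 1 := by nlinarith [sq_nonneg (2 * P + Q)]
    have hP : P ^ 2 ≤ 1 := by nlinarith [sq_nonneg (2 * Q + P)]
    obtain ⟨hQ1, hQ2⟩ := abs_le_one_of_sq_le_one hQ
    obtain ⟨hP1, hP2⟩ := abs_le_one_of_sq_le_one hP
    interval_cases P <;> interval_cases Q <;> omega
  · rintro (⟨rfl, rfl⟩ | ⟨rfl, rfl⟩ | ⟨rfl, rfl⟩ | ⟨rfl, rfl⟩ | ⟨rfl, rfl⟩ | ⟨rfl, rfl⟩) <;> norm_num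

/-- **In-layer separation**: off the origin the form is `≥ 12`. [folklore] -/
theorem twelve_le_inLayer {P Q : ℤ} (h : (P, Q) ≠ (0, 0)) :
    12 ≤ 3 * (2 * P + Q) ^ 2 + (3 * Q) ^ 2 := by
  by_contra hlt
  push Not at hlt
  have hQ : Q ^ 2 ≤ 1 := by nlinarith [sq_nonneg (2 * P + Q)]
  have hP : P ^ 2 ≤ 1 := by nlinarith [sq_nonneg (2 * Q + P)]
  obtain ⟨hQ1, hQ2⟩ := abs_le_one_of_sq_le_one hQ
  obtain ⟨hP1, hP2⟩ := abs_le_one_of_sq_le_one hP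
  interval_cases P <;> interval_cases Q <;> simp_all

/-- **Adjacent-layer shell, letter shift `+1`**: `3(2P+Q+1)² + (3Q+1)² = 4` has exactly the three
solutions `(0,0), (−1,0), (0,−1)` — the three touching balls of the next layer. [folklore] -/
theorem adjLayer_pos_eq_four_iff (P Q : ℤ) :
    3 * (2 * P + Q + 1) ^ 2 + (3 * Q + 1) ^ 2 = 4 ↔
      (P = 0 ∧ Q = 0) ∨ (P = -1 ∧ Q = 0) ∨ (P = 0 ∧ Q = -1) := by
  constructor
  · intro h
    have hv : (3 * Q + 1) ^ 2 ≤ 4 := by nlinarith [sq_nonneg (2 * P + Q + 1)]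
    have hu3 : 3 * (2 * P + Q + 1) ^ 2 ≤ 4 := by nlinarith [sq_nonneg (3 * Q + 1)]
    have hu : (2 * P + Q + 1) ^ 2 ≤ 1 := by omega
    obtain ⟨hv1, hv2⟩ := abs_le_two_of_sq_le_four hv
    obtain ⟨hu1, hu2⟩ := abs_le_one_of_sq_le_one hu
    have hQ1 : -1 ≤ Q := by omega
    have hQ2 : Q ≤ 0 := by omega
    have hP1 : -1 ≤ P := by omega
    have hP2 : P ≤ 1 := by omega
    interval_cases P <;> interval_cases Q <;> omega
  · rintro (⟨rfl, rfl⟩ | ⟨rfl, rfl⟩ | ⟨rfl, rfl⟩) <;> norm_num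

/-- **Adjacent-layer shell, letter shift `−1`**: the three solutions `(0,0), (1,0), (0,1)`.
[folklore] -/
theorem adjLayer_neg_eq_four_iff (P Q : ℤ) :
    3 * (2 * P + Q + -1) ^ 2 + (3 * Q + -1) ^ 2 = 4 ↔
      (P = 0 ∧ Q = 0) ∨ (P = 1 ∧ Q = 0) ∨ (P = 0 ∧ Q = 1) := by
  have h := adjLayer_pos_eq_four_iff (-P) (-Q)
  constructor
  · intro h1
    have h2 : 3 * (2 * -P + -Q + 1) ^ 2 + (3 * -Q + 1) ^ 2 = 4 := by linear_combination h1
    rcases h.1 h2 with h3 | h3 | h3 <;> omega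
  · rintro (⟨rfl, rfl⟩ | ⟨rfl, rfl⟩ | ⟨rfl, rfl⟩) <;> norm_num

/-- **Adjacent-layer separation**: for a letter shift `σ = ±1` the form is `≥ 4` everywhere
(`3Q + σ ≢ 0 (mod 3)`, and if `(3Q+σ)² = 1` then `Q = 0` and `2P + σ` is odd). [folklore] -/
theorem four_le_adjLayer {P Q σ : ℤ} (hσ : σ = 1 ∨ σ = -1) :
    4 ≤ 3 * (2 * P + Q + σ) ^ 2 + (3 * Q + σ) ^ 2 := by
  by_contra hlt
  push Not at hlt
  have hv : (3 * Q + σ) ^ 2 ≤ 4 := by nlinarith [sq_nonneg (2 * P + Q + σ)]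
  have hu3 : 3 * (2 * P + Q + σ) ^ 2 ≤ 4 := by nlinarith [sq_nonneg (3 * Q + σ)]
  have hu : (2 * P + Q + σ) ^ 2 ≤ 1 := by omega
  obtain ⟨hv1, hv2⟩ := abs_le_two_of_sq_le_four hv
  obtain ⟨hu1, hu2⟩ := abs_le_one_of_sq_le_one hu
  rcases hσ with rfl | rfl
  · have hQ1 : -1 ≤ Q := by omega
    have hQ2 : Q ≤ 0 := by omega
    have hP1 : -1 ≤ P := by omega
    have hP2 : P ≤ 1 := by omega
    interval_cases P <;> interval_cases Q <;> omega
  · have hQ1 : 0 ≤ Q := by omega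
    have hQ2 : Q ≤ 1 := by omega
    have hP1 : -1 ≤ P := by omega
    have hP2 : P ≤ 1 := by omega
    interval_cases P <;> interval_cases Q <;> omega

/-! ## The distance form of the ideal stacking -/

section Ideal

variable {a h : ℝ} {s : ℤ → ℤ}

/-- **`12 · dist² = a² · (3(2P+Q+Λ)² + (3Q+Λ)² + 8K²)`** for the ideal layer spacing `h² = ⅔a²`,
with `P = i − i'`, `Q = j − j'`, `K = k − k'`, `Λ = L(k) − L(k')`. [folklore] -/
theorem twelve_mul_dist_barlowPos_sq (hh : h ^ 2 = 2 / 3 * a ^ 2) (s : ℤ → ℤ)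
    (k i j k' i' j' : ℤ) :
    12 * dist (barlowPos a h s k i j) (barlowPos a h s k' i' j') ^ 2 =
      a ^ 2 * ((3 * (2 * (i - i') + (j - j') + (haggLabel s k - haggLabel s k')) ^ 2 +
        (3 * (j - j') + (haggLabel s k - haggLabel s k')) ^ 2 + 8 * (k - k') ^ 2 : ℤ) : ℝ) := by
  rw [dist_barlowPos_sq]
  have h3 : (√3 : ℝ) ^ 2 = 3 := Real.sq_sqrt (by norm_num)
  push_cast
  linear_combination (3 * a ^ 2 * ((j : ℝ) - j' + ((haggLabel s k : ℝ) - haggLabel s k') / 3) ^ 2) * h3 +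
    12 * ((k : ℝ) - k') ^ 2 * hh

/-- The letter shift across one layer upwards is `s k`. [folklore] -/
theorem haggLabel_sub_haggLabel_succ (s : ℤ → ℤ) (k : ℤ) :
    haggLabel s k - haggLabel s (k + 1) = -s k := by
  rw [haggLabel_succ]; ring

/-- The letter shift across one layer downwards is `s (k − 1)`. [folklore] -/
theorem haggLabel_sub_haggLabel_pred (s : ℤ → ℤ) (k : ℤ) :
    haggLabel s k - haggLabel s (k - 1) = s (k - 1) := by
  have := haggLabel_succ s (k - 1)
  rw [sub_add_cancel] at this
  linarith

/-- `dist = a` iff the integer form equals `12` (for `a > 0`). [folklore] -/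
theorem dist_barlowPos_eq_iff_form (ha : 0 < a) (hh : h ^ 2 = 2 / 3 * a ^ 2) (s : ℤ → ℤ)
    (k i j k' i' j' : ℤ) :
    dist (barlowPos a h s k i j) (barlowPos a h s k' i' j') = a ↔
      3 * (2 * (i - i') + (j - j') + (haggLabel s k - haggLabel s k')) ^ 2 +
        (3 * (j - j') + (haggLabel s k - haggLabel s k')) ^ 2 + 8 * (k - k') ^ 2 = 12 := by
  have h12 := twelve_mul_dist_barlowPos_sq hh s k i j k' i' j'
  set F : ℤ := 3 * (2 * (i - i') + (j - j') + (haggLabel s k - haggLabel s k')) ^ 2 +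
    (3 * (j - j') + (haggLabel s k - haggLabel s k')) ^ 2 + 8 * (k - k') ^ 2 with hF
  have ha2 : 0 < a ^ 2 := by positivity
  constructor
  · intro hd
    rw [hd] at h12
    have : (F : ℝ) = 12 := by nlinarith
    exact_mod_cast this
  · intro hF12
    rw [hF12] at h12
    push_cast at h12
    have hd2 : dist (barlowPos a h s k i j) (barlowPos a h s k' i' j') ^ 2 = a ^ 2 := by nlinarith
    exact (sq_eq_sq₀ dist_nonneg ha.le).1 hd2

/-- **Packing property of the ideal stacking**: for a Hägg sequence, `a > 0` and `h² = ⅔a²`,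
distinct points of `barlowStacking a h s` are at distance `≥ a`. (`BarlowStacking.le_dist_barlowPos`
only gives `≥ min a h = h ≈ 0.816 a`.) [cite: HalesDSP2012, §1.3] -/
theorem le_dist_barlowPos_of_ideal (hs : IsHaggSeq s) (ha : 0 < a) (hh : h ^ 2 = 2 / 3 * a ^ 2)
    {k i j k' i' j' : ℤ} (hne : (k, i, j) ≠ (k', i', j')) :
    a ≤ dist (barlowPos a h s k i j) (barlowPos a h s k' i' j') := by
  have h12 := twelve_mul_dist_barlowPos_sq hh s k i j k' i' j'
  set Λ : ℤ := haggLabel s k - haggLabel s k' with hΛ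
  -- the integer form is at least 12
  have hF : (12 : ℤ) ≤ 3 * (2 * (i - i') + (j - j') + Λ) ^ 2 + (3 * (j - j') + Λ) ^ 2 +
      8 * (k - k') ^ 2 := by
    rcases lt_trichotomy (k - k') 0 with hK | hK | hK
    · rcases eq_or_lt_of_le (Int.le_sub_one_iff.2 hK : k - k' ≤ -1) with hK1 | hK1
      · -- `k' = k + 1`, `Λ = -s k`
        have hk' : k' = k + 1 := by omega
        have hΛ' : Λ = -s k := by rw [hΛ, hk', haggLabel_sub_haggLabel_succ]
        have hσ : -s k = 1 ∨ -s k = -1 := by rcases hs k with h1 | h1 <;> omega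
        have h4 := four_le_adjLayer (P := i - i') (Q := j - j') hσ
        rw [hΛ', hK1]; nlinarith
      · nlinarith [sq_nonneg (2 * (i - i') + (j - j') + Λ), sq_nonneg (3 * (j - j') + Λ)]
    · -- same layer, `Λ = 0`, `(P, Q) ≠ 0`
      have hk' : k' = k := by omega
      have hΛ0 : Λ = 0 := by rw [hΛ, hk', sub_self]
      have hPQ : (i - i', j - j') ≠ (0, 0) := by
        intro h0
        simp only [Prod.mk.injEq, sub_eq_zero] at h0
        exact hne (by rw [hk', h0.1, h0.2])
      have := twelve_le_inLayer hPQ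
      rw [hΛ0, hK]; simpa using this
    · rcases eq_or_lt_of_le (Int.add_one_le_iff.2 hK : 1 ≤ k - k') with hK1 | hK1
      · -- `k' = k - 1`, `Λ = s (k-1)`
        have hk' : k' = k - 1 := by omega
        have hΛ' : Λ = s (k - 1) := by rw [hΛ, hk', haggLabel_sub_haggLabel_pred]
        have hσ : s (k - 1) = 1 ∨ s (k - 1) = -1 := hs (k - 1)
        have h4 := four_le_adjLayer (P := i - i') (Q := j - j') hσ
        rw [hΛ', ← hK1]; nlinarith
      · nlinarith [sq_nonneg (2 * (i - i') + (j - j') + Λ), sq_nonneg (3 * (j - j') + Λ)]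
  have hF' : (12 : ℝ) ≤ ((3 * (2 * (i - i') + (j - j') + Λ) ^ 2 + (3 * (j - j') + Λ) ^ 2 +
      8 * (k - k') ^ 2 : ℤ) : ℝ) := by exact_mod_cast hF
  have ha2 : 0 < a ^ 2 := by positivity
  have hd2 : a ^ 2 ≤ dist (barlowPos a h s k i j) (barlowPos a h s k' i' j') ^ 2 := by nlinarith
  exact (pow_le_pow_iff_left₀ ha.le dist_nonneg two_ne_zero).1 hd2

/-! ## The twelve neighbours -/

/-- The six in-layer neighbour offsets `(P, Q) = (i − i', j − j')`. [folklore] -/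
def sixOffsets : Finset (ℤ × ℤ) := {(1, 0), (-1, 0), (0, 1), (0, -1), (1, -1), (-1, 1)}

/-- The three adjacent-layer neighbour offsets for the letter shift `σ` (`σ = 1`: `(0,0), (−1,0),
(0,−1)`; `σ = −1`: `(0,0), (1,0), (0,1)`). [folklore] -/
def threeOffsets (σ : ℤ) : Finset (ℤ × ℤ) :=
  if σ = 1 then {(0, 0), (-1, 0), (0, -1)} else {(0, 0), (1, 0), (0, 1)}

/-- There are six in-layer offsets. [folklore] -/
theorem card_sixOffsets : sixOffsets.card = 6 := by decide

/-- There are three adjacent-layer offsets. [folklore] -/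
theorem card_threeOffsets (σ : ℤ) : (threeOffsets σ).card = 3 := by
  unfold threeOffsets; split_ifs <;> decide

/-- Membership in `sixOffsets` is the in-layer shell equation. [folklore] -/
theorem mem_sixOffsets_iff {P Q : ℤ} :
    (P, Q) ∈ sixOffsets ↔ 3 * (2 * P + Q) ^ 2 + (3 * Q) ^ 2 = 12 := by
  rw [inLayer_eq_twelve_iff]
  simp only [sixOffsets, Finset.mem_insert, Finset.mem_singleton, Prod.mk.injEq]

/-- Membership in `threeOffsets σ` is the adjacent-layer shell equation. [folklore] -/
theorem mem_threeOffsets_iff {P Q σ : ℤ} (hσ : σ = 1 ∨ σ = -1) :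
    (P, Q) ∈ threeOffsets σ ↔ 3 * (2 * P + Q + σ) ^ 2 + (3 * Q + σ) ^ 2 = 4 := by
  rcases hσ with rfl | rfl
  · rw [adjLayer_pos_eq_four_iff]
    simp only [threeOffsets, if_true, Finset.mem_insert, Finset.mem_singleton, Prod.mk.injEq]
  · rw [adjLayer_neg_eq_four_iff]
    simp only [threeOffsets, show (-1 : ℤ) ≠ 1 by decide, if_false, Finset.mem_insert,
      Finset.mem_singleton, Prod.mk.injEq]

/-- **The shell of a point of the ideal stacking**: `barlowPos a h s k' i' j'` is at distance
exactly `a` from `barlowPos a h s k i j` iff it is one of its six in-layer neighbours, or one of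
three points of layer `k + 1` (offsets `threeOffsets (−s k)`), or one of three points of layer
`k − 1` (offsets `threeOffsets (s (k−1))`). [cite: HalesDSP2012, §1.3] -/
theorem dist_barlowPos_eq_iff (hs : IsHaggSeq s) (ha : 0 < a) (hh : h ^ 2 = 2 / 3 * a ^ 2)
    (k i j k' i' j' : ℤ) :
    dist (barlowPos a h s k i j) (barlowPos a h s k' i' j') = a ↔
      (k' = k ∧ (i - i', j - j') ∈ sixOffsets) ∨
      (k' = k + 1 ∧ (i - i', j - j') ∈ threeOffsets (-s k)) ∨
      (k' = k - 1 ∧ (i - i', j - j') ∈ threeOffsets (s (k - 1))) := by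
  rw [dist_barlowPos_eq_iff_form ha hh]
  have hsp : -s k = 1 ∨ -s k = -1 := by rcases hs k with h1 | h1 <;> omega
  have hsm : s (k - 1) = 1 ∨ s (k - 1) = -1 := hs (k - 1)
  constructor
  · intro hF
    have hK2 : (k - k') ^ 2 ≤ 1 := by
      nlinarith [sq_nonneg (2 * (i - i') + (j - j') + (haggLabel s k - haggLabel s k')),
        sq_nonneg (3 * (j - j') + (haggLabel s k - haggLabel s k'))]
    obtain ⟨hK1, hK1'⟩ := abs_le_one_of_sq_le_one hK2
    rcases (show k' = k + 1 ∨ k' = k ∨ k' = k - 1 by omega) with hk' | hk' | hk'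
    · subst hk'
      rw [haggLabel_sub_haggLabel_succ] at hF
      refine Or.inr (Or.inl ⟨rfl, (mem_threeOffsets_iff hsp).2 ?_⟩)
      have e8 : (8 : ℤ) * (k - (k + 1)) ^ 2 = 8 := by ring
      linarith
    · subst hk'
      rw [sub_self] at hF
      refine Or.inl ⟨rfl, mem_sixOffsets_iff.2 ?_⟩
      simpa using hF
    · subst hk'
      rw [haggLabel_sub_haggLabel_pred] at hF
      refine Or.inr (Or.inr ⟨rfl, (mem_threeOffsets_iff hsm).2 ?_⟩)
      have e8 : (8 : ℤ) * (k - (k - 1)) ^ 2 = 8 := by ring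
      linarith
  · rintro (⟨rfl, hm⟩ | ⟨rfl, hm⟩ | ⟨rfl, hm⟩)
    · rw [sub_self]
      have := mem_sixOffsets_iff.1 hm
      simpa using this
    · rw [haggLabel_sub_haggLabel_succ]
      have := (mem_threeOffsets_iff hsp).1 hm
      have e8 : (8 : ℤ) * (k - (k + 1)) ^ 2 = 8 := by ring
      linarith
    · rw [haggLabel_sub_haggLabel_pred]
      have := (mem_threeOffsets_iff hsm).1 hm
      have e8 : (8 : ℤ) * (k - (k - 1)) ^ 2 = 8 := by ring
      linarith

/-- The parametrisation of layer `k'` by offsets from `(i, j)`. [folklore] -/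
def offsetPos (a h : ℝ) (s : ℤ → ℤ) (i j k' : ℤ) (PQ : ℤ × ℤ) : EuclideanSpace ℝ (Fin 3) :=
  barlowPos a h s k' (i - PQ.1) (j - PQ.2)

/-- `offsetPos` is injective on offsets (in-layer separation). [folklore] -/
theorem offsetPos_injective (ha : 0 < a) (i j k' : ℤ) :
    Function.Injective (offsetPos a h s i j k') := by
  intro PQ PQ' heq
  by_contra hne
  have hne' : (i - PQ.1, j - PQ.2) ≠ (i - PQ'.1, j - PQ'.2) := by
    intro h0
    apply hne
    simp only [Prod.mk.injEq] at h0
    exact Prod.ext (by omega) (by omega)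
  have := le_dist_barlowPos_of_ne a h s ha.le (k := k') hne'
  simp only [offsetPos] at heq
  rw [heq, dist_self] at this
  linarith

/-- Points of different layers differ (their third coordinates are `k h ≠ k' h`). [folklore] -/
theorem offsetPos_layer_eq (hh0 : h ≠ 0) {i j k₁ k₂ : ℤ} {PQ PQ' : ℤ × ℤ}
    (heq : offsetPos a h s i j k₁ PQ = offsetPos a h s i j k₂ PQ') : k₁ = k₂ := by
  have := congrArg (fun v : EuclideanSpace ℝ (Fin 3) => v 2) heq
  simp only [offsetPos, barlowPos_apply_two] at this
  exact_mod_cast mul_right_cancel₀ hh0 this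

/-- **The shell as a set**: the points of the stacking at distance `a` from `barlowPos a h s k i j`
are the images of the twelve offsets. [folklore] -/
theorem touching_eq_union (hs : IsHaggSeq s) (ha : 0 < a) (hh : h ^ 2 = 2 / 3 * a ^ 2)
    (k i j : ℤ) :
    {w | w ∈ barlowStacking a h s ∧ dist (barlowPos a h s k i j) w = a} =
      offsetPos a h s i j k '' ↑sixOffsets ∪
        (offsetPos a h s i j (k + 1) '' ↑(threeOffsets (-s k)) ∪
          offsetPos a h s i j (k - 1) '' ↑(threeOffsets (s (k - 1)))) := by
  ext w
  simp only [mem_setOf_eq, mem_union, mem_image, Finset.mem_coe]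
  constructor
  · rintro ⟨⟨k', i', j', rfl⟩, hd⟩
    rcases (dist_barlowPos_eq_iff hs ha hh k i j k' i' j').1 hd with
      ⟨rfl, hm⟩ | ⟨rfl, hm⟩ | ⟨rfl, hm⟩
    · exact Or.inl ⟨(i - i', j - j'), hm, by simp [offsetPos]⟩
    · exact Or.inr (Or.inl ⟨(i - i', j - j'), hm, by simp [offsetPos]⟩)
    · exact Or.inr (Or.inr ⟨(i - i', j - j'), hm, by simp [offsetPos]⟩)
  · rintro (⟨PQ, hm, rfl⟩ | ⟨PQ, hm, rfl⟩ | ⟨PQ, hm, rfl⟩) <;>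
      refine ⟨barlowPos_mem _ _ _, (dist_barlowPos_eq_iff hs ha hh k i j _ _ _).2 ?_⟩
    · exact Or.inl ⟨rfl, by simpa using hm⟩
    · exact Or.inr (Or.inl ⟨rfl, by simpa using hm⟩)
    · exact Or.inr (Or.inr ⟨rfl, by simpa using hm⟩)

/-- **Twelve neighbours** (Hales, *Dense Sphere Packings* §1.3; Conway–Sloane: `S(1) = 12` for
every Barlow packing): in the ideal stacking of a Hägg sequence, exactly twelve points of the
stacking are at distance `a` from `barlowPos a h s k i j` — six in its layer, three above,
three below. [cite: HalesDSP2012, §1.3] [cite: ConwaySloane1999, Preface 3rd ed., Notes on Ch. 4] -/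
theorem ncard_touching_barlowPos (hs : IsHaggSeq s) (ha : 0 < a) (hh : h ^ 2 = 2 / 3 * a ^ 2)
    (k i j : ℤ) :
    {w | w ∈ barlowStacking a h s ∧ dist (barlowPos a h s k i j) w = a}.ncard = 12 := by
  have hh0 : h ≠ 0 := by
    intro h0
    rw [h0] at hh
    nlinarith
  rw [touching_eq_union hs ha hh]
  have hinj := fun k' => offsetPos_injective (h := h) (s := s) ha i j k'
  have hlay : ∀ {k₁ k₂ : ℤ} (A B : Finset (ℤ × ℤ)), k₁ ≠ k₂ →
      Disjoint (offsetPos a h s i j k₁ '' ↑A) (offsetPos a h s i j k₂ '' ↑B) := by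
    intro k₁ k₂ A B hk
    refine Set.disjoint_left.2 ?_
    rintro _ ⟨PQ, _, rfl⟩ ⟨PQ', _, heq⟩
    exact hk (offsetPos_layer_eq hh0 heq.symm)
  have hfin : ∀ (k' : ℤ) (A : Finset (ℤ × ℤ)), (offsetPos a h s i j k' '' ↑A).Finite :=
    fun k' A => A.finite_toSet.image _
  rw [Set.ncard_union_eq ((hlay _ _ (by omega)).union_right (hlay _ _ (by omega))) (hfin _ _)
      ((hfin _ _).union (hfin _ _)),
    Set.ncard_union_eq (hlay _ _ (by omega)) (hfin _ _) (hfin _ _),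
    Set.ncard_image_of_injective _ (hinj _), Set.ncard_image_of_injective _ (hinj _),
    Set.ncard_image_of_injective _ (hinj _), Set.ncard_coe_finset, Set.ncard_coe_finset,
    Set.ncard_coe_finset, card_sixOffsets, card_threeOffsets, card_threeOffsets]

/-- **Every point of the ideal stacking has exactly twelve points of the stacking at distance `a`.**
[cite: HalesDSP2012, §1.3] [cite: ConwaySloane1999, Preface 3rd ed., Notes on Ch. 4] -/
theorem ncard_touching_eq_twelve (hs : IsHaggSeq s) (ha : 0 < a) (hh : h ^ 2 = 2 / 3 * a ^ 2)
    {u : EuclideanSpace ℝ (Fin 3)} (hu : u ∈ barlowStacking a h s) :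
    {w | w ∈ barlowStacking a h s ∧ dist u w = a}.ncard = 12 := by
  obtain ⟨k, i, j, rfl⟩ := hu
  exact ncard_touching_barlowPos hs ha hh k i j

/-- **The ideal stacking is a packing of balls of diameter `a`**, as a statement about the point
set. [cite: HalesDSP2012, §1.3] -/
theorem le_dist_of_mem_barlowStacking_ideal (hs : IsHaggSeq s) (ha : 0 < a)
    (hh : h ^ 2 = 2 / 3 * a ^ 2) {x y : EuclideanSpace ℝ (Fin 3)}
    (hx : x ∈ barlowStacking a h s) (hy : y ∈ barlowStacking a h s) (hxy : x ≠ y) :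
    a ≤ dist x y := by
  obtain ⟨k, i, j, rfl⟩ := hx
  obtain ⟨k', i', j', rfl⟩ := hy
  refine le_dist_barlowPos_of_ideal hs ha hh ?_
  rintro heq
  simp only [Prod.mk.injEq] at heq
  obtain ⟨rfl, rfl, rfl⟩ := heq
  exact hxy rfl

end Ideal

end Literature.MathematicalPhysics.StatisticalMechanics

end
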